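import Literature.AlgebraicGeometry.HodgeTheory.HypersurfaceFamilyResidueFrame
import Literature.AlgebraicGeometry.HodgeTheory.HodgeFrameOfRelativeForms
import HarnessLib

/-!
# Holomorphic frames of `FⁿHⁿ` in flat coordinates for the specialised families of smooth hypersurfaces

Family `hodge`, layer `Literature/AlgebraicGeometry/HodgeTheory`. Theorems only; no definition, no named
fact. Written by the prover seat `hodge-nonav-prover-Ax` (g12, cell `hodge-nonav`) as brick FF4 — the
keystone — of the programme «GRIFFITHS-SURFACES / B4 RELATIVE RESIDUES» (route
`HodgeConjecture/CyclicUnitaryPowers`, `--supports stmt-HodgeConjecture-19544`).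

`exists_topFormFrame_familySpz`: for the smooth projective family of hypersurfaces
`f = familySpz ℂ n d sp : 𝒴_sp ⟶ S_sp` (`n = n₀ + 1 ≥ 1`, `d ≥ n + 2`, base smooth of relative dimension
`m`, cohomologically locally trivial), Hodge-symmetric models `A t` of the fibres, base points `s, t₁` and
an identification `T₁ : Hⁿ(X_s; ℚ) ≃ Hⁿ(X_{t₁}; ℚ)`: near `t₁` there are a path-connected open `W₀` inside a
holomorphic chart `ψ` of the base and finitely many functions `w₂ i : W₀ → ℂ ⊗ Hⁿ(X_s; ℚ)` such that,
for every `t ∈ W₀` and every continuation `T` of `T₁` along a path inside `W₀`, the `w₂ i t` are linearly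
independent and span the transported `FⁿHⁿ(X_t)` (`((A t).hodgeStructure …).comapEquiv T).F n`), and every
coordinate `z ↦ φ (w₂ i (ψ.symm z))` is HOLOMORPHIC on `ψ '' W₀`. This is literally the hypothesis `hF2`
(at `2 ↦ n`) of `hodgeLociDichotomy_of_weightTwoFrames` / `isMeagre_setOf_not_isHodgeGenericPoint_of_weightTwoFrames`
— Griffiths' theorem «the Hodge bundle `Fⁿ` is a holomorphic subbundle of the flat bundle» for these
families, PROVED (no named fact): the frame is given by the periods of the glued relative residue forms
`Ξ_j` of a basis of `S^{d−n−2}` (`exists_residueFrame_familySpz`: Griffiths residues span `FⁿHⁿ` of a smooth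
hypersurface, Voisin II §6.1.3; glued on the total space, Voisin II §6.2.1) fed into the generic frame
assembly `exists_weightFrames_of_relativeForms` (prover-Bx: Ehresmann trivialisation over a chart ball,
holomorphic dependence of the periods `∫ γ ∧ Φ_p^*Ξ_j` on `p`, Voisin I §9.1–§9.3 and §10.2.2; flat
coordinates by Poincaré duality). HONEST FRAMING: nothing here says HC is proved; the crux item 19544 as
typed still needs CDK.

## References

* [Griffiths1968PeriodsII] P. Griffiths, Periods of integrals on algebraic manifolds II, Amer. J. Math. 90
  (1968), Thm. 1.1.
* [VoisinHodgeII2003] C. Voisin, Hodge Theory and Complex Algebraic Geometry II (2003), §6.1.3, §6.2.1.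
* [VoisinHodgeI2002] C. Voisin, Hodge Theory and Complex Algebraic Geometry I (2002), §9.3, §10.2.2.
-/

noncomputable section

open scoped Manifold ContDiff Topology TensorProduct
open CategoryTheory AlgebraicGeometry Set Filter Complex
open _root_.Topology
open Literature.NumberTheory.Transcendental Literature.Geometry.Kaehler Literature.AlgebraicGeometry.Motives
open Literature.AlgebraicGeometry.Motives.UniversalHypersurface
open Literature.AlgebraicGeometry.HodgeTheory.UniversalHypersurface
open Literature.AlgebraicTopology.SingularHomology

namespace Literature.AlgebraicGeometry.HodgeTheory

set_option backward.isDefEq.respectTransparency false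


section FF4

variable (n₀ d : ℕ) {σ : Type} [Finite σ] (sp : CoeffRing ℂ (n₀ + 1) d →ₐ[ℂ] MvPolynomial σ ℂ)

/-- **Holomorphic frames of `FⁿHⁿ` in flat coordinates for the family of smooth hypersurfaces
`𝒴_sp ⟶ S_sp`** (see the module docstring) — exactly the hypothesis `hF2` (at `2 ↦ n₀ + 1`, without its
unused continuation clause for `T₁`) of `hodgeLociDichotomy_of_weightTwoFrames`: Griffiths' holomorphy of
the Hodge subbundle `Fⁿ ⊂ Hⁿ ⊗ 𝒪` for these families, by periods of relative residue forms.
[cite: Griffiths1968PeriodsII, Thm. 1.1] [cite: VoisinHodgeII2003, §6.1.3 and §6.2.1]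
[cite: VoisinHodgeI2002, §10.2.2 and Thm. 9.3] -/
theorem exists_topFormFrame_familySpz (hd : n₀ + 1 + 2 ≤ d) (m : ℕ)
    [AlgebraicGeometry.SmoothOfRelativeDimension m (baseSpz ℂ (n₀ + 1) d sp).hom]
    (hf : IsSmoothProjectiveFamily (familySpz ℂ (n₀ + 1) d sp) (n₀ + 1))
    (hU : IsCohomologicallyLocallyTrivialOn (familySpz ℂ (n₀ + 1) d sp)
      (Set.univ : Set (ComplexPoints (baseSpz ℂ (n₀ + 1) d sp))))
    (A : ∀ t : ComplexPoints (baseSpz ℂ (n₀ + 1) d sp),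
      HodgeModel (n₀ + 1) (fiberOver (familySpz ℂ (n₀ + 1) d sp) t))
    (hA : ∀ t, (A t).IsHodgeSymmetric)
    (s t₁ : (Set.univ : Set (ComplexPoints (baseSpz ℂ (n₀ + 1) d sp))))
    (N : Set (Set.univ : Set (ComplexPoints (baseSpz ℂ (n₀ + 1) d sp)))) (hN : N ∈ 𝓝 t₁)
    (T₁ : singularCohomology ℚ ℚ (ComplexPoints (fiberOver (familySpz ℂ (n₀ + 1) d sp) s.1)) (n₀ + 1) ≃ₗ[ℚ]
      singularCohomology ℚ ℚ (ComplexPoints (fiberOver (familySpz ℂ (n₀ + 1) d sp) t₁.1)) (n₀ + 1)) :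
    ∃ W₀ : Set (Set.univ : Set (ComplexPoints (baseSpz ℂ (n₀ + 1) d sp))), IsOpen W₀ ∧ t₁ ∈ W₀ ∧ W₀ ⊆ N ∧
      IsPathConnected W₀ ∧
    ∃ ψ : OpenPartialHomeomorph (Set.univ : Set (ComplexPoints (baseSpz ℂ (n₀ + 1) d sp))) (Fin m → ℂ),
      W₀ ⊆ ψ.source ∧
    ∃ (r₂ : ℕ) (w₂ : Fin r₂ → Set.Elem (Set.univ : Set (ComplexPoints (baseSpz ℂ (n₀ + 1) d sp))) →
      ℂ ⊗[ℚ] singularCohomology ℚ ℚ (ComplexPoints (fiberOver (familySpz ℂ (n₀ + 1) d sp) s.1)) (n₀ + 1)),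
      (∀ t ∈ W₀, ∀ (ε' : Path t₁ t), (∀ r', ε' r' ∈ W₀) →
        ∀ (T : singularCohomology ℚ ℚ (ComplexPoints (fiberOver (familySpz ℂ (n₀ + 1) d sp) s.1)) (n₀ + 1)
          ≃ₗ[ℚ] singularCohomology ℚ ℚ (ComplexPoints (fiberOver (familySpz ℂ (n₀ + 1) d sp) t.1)) (n₀ + 1)),
        (∀ v, ofRatClass _ (n₀ + 1) (T v) =
          transportFun (familySpz ℂ (n₀ + 1) d sp) (n₀ + 1) hU ⟦ε'⟧ (ofRatClass _ (n₀ + 1) (T₁ v))) →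
        LinearIndependent ℂ (fun i ↦ w₂ i t) ∧
          (((A t.1).hodgeStructure (hf.isSmoothProjective t.1) (hA t.1) (n₀ + 1)).comapEquiv T).F (n₀ + 1) =
            Submodule.span ℂ (Set.range fun i ↦ w₂ i t)) ∧
      (∀ (i : Fin r₂) (φ : Module.Dual ℂ (ℂ ⊗[ℚ] singularCohomology ℚ ℚ
          (ComplexPoints (fiberOver (familySpz ℂ (n₀ + 1) d sp) s.1)) (n₀ + 1))),
        AnalyticOnNhd ℂ (fun z ↦ φ (w₂ i (ψ.symm z))) (ψ '' W₀)) := by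
  haveI : IsSeparated (baseSpz ℂ (n₀ + 1) d sp).hom := isSeparated_baseSpz_hom ℂ (n₀ + 1) d sp
  haveI : SecondCountableTopology (ComplexPoints (totalSpz ℂ (n₀ + 1) d sp)) :=
    secondCountableTopology_complexPoints_totalSpz n₀ d sp hf
  obtain ⟨r, Ξ, W, hWo, ht₁W, -, hΞs, hdΞ, hframe⟩ := exists_residueFrame_familySpz n₀ d sp (m := m) hf hd t₁.1
  refine exists_weightFrames_of_relativeForms (familySpz ℂ (n₀ + 1) d sp) (m := m) (Nat.le_add_left 1 n₀)
    hf hU A hA s t₁ N hN T₁ hWo ht₁W Ξ hΞs hdΞ fun t ht ↦ ?_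
  obtain ⟨x, β, hβ, hx, hli, hspan⟩ := hframe t ht
  exact ⟨x, β, hβ, hx, hli, hspan (A t) (hA t)⟩

end FF4

end Literature.AlgebraicGeometry.HodgeTheory

end
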